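import Mathlib
import HarnessLib
import Summits.ValiantsHypothesis.ValiantsHypothesis.Theses.MonotoneRestoration
import Literature.Computability.AlgebraicComplexity.ArithCircuit
import Literature.Computability.AlgebraicComplexity.ArithCircuitProofs
import Literature.Computability.AlgebraicComplexity.MonotoneStructure
import Literature.Computability.AlgebraicComplexity.PermanentIrreducible
import Literature.ModelTheory.FiniteModelTheory.CkEquiv
import Summits.ValiantsHypothesis.ValiantsHypothesis.Theorems.MonotoneRestorationMonotoneRestorationQPCosetCount
import Summits.ValiantsHypothesis.ValiantsHypothesis.Theorems.MonotoneRestorationMonotoneRestorationQPSymmetricLB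
import Summits.ValiantsHypothesis.ValiantsHypothesis.Theorems.MonotoneRestorationMonotoneRestorationQPSupportSymmetrisation
import Summits.ValiantsHypothesis.ValiantsHypothesis.Theorems.MonotoneRestorationMonotoneRestorationQPSparseRegime
import Summits.ValiantsHypothesis.ValiantsHypothesis.Theorems.MonotoneRestorationMonotoneRestorationQPBeta
import Literature.Computability.AlgebraicComplexity.SymmetricArithCircuit
import Literature.Computability.AlgebraicComplexity.DawarWilsenach2025Proofs
import Literature.GroupTheory.PermutationGroups.SmallIndexSubgroups
import Summits.ValiantsHypothesis.ValiantsHypothesis.Theorems.MonotoneRestorationQP.Negative.LoadBearing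
import Summits.ValiantsHypothesis.ValiantsHypothesis.Theorems.MonotoneRestorationMonotoneRestorationQPPermSupportCount

/-! TTRL-lite variant V19209 of stmt-ValiantsHypothesis-15886 -/

-- `Summit.ValiantsHypothesis.ValiantsHypothesis.…` is the tree's mandated single-conjunct layout
-- (Sub = Summit), so the duplicated namespace component is intended.
set_option linter.dupNamespace false

namespace Summit.ValiantsHypothesis.ValiantsHypothesis.Theorems

open Summit.ValiantsHypothesis.ValiantsHypothesis.Theses.MonotoneRestoration
open Literature.Computability.AlgebraicComplexity

/-- **TTRL-lite variant V19209** of `stub_esymmRowSums_structure` (`n = 2`, `k = n / 2 = 1`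
closed form): substituting the row sums `R_i = x_{i,0} + x_{i,1}` of the `2 × 2` variable matrix
into `e_1(y_0, y_1) = y_0 + y_1` gives the sum of all four variables,
`x_{0,0} + x_{0,1} + x_{1,0} + x_{1,1}`. Proof: `esymm σ R 1 = Σ_i X i`, `bind₁` is an algebra map
(so it commutes with the sum and sends `X i` to `R_i`), then `Fin.sum_univ_two` and reassociation.
[folklore] -/
theorem stub_esymmRowSums_structure_var19209 :
    MvPolynomial.bind₁ (fun i : Fin 2 => ∑ j : Fin 2, MvPolynomial.X (i, j))
      (MvPolynomial.esymm (Fin 2) NNReal 1) =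
      MvPolynomial.X (0, 0) + MvPolynomial.X (0, 1) + MvPolynomial.X (1, 0) +
        MvPolynomial.X (1, 1) := by
  rw [MvPolynomial.esymm_one, map_sum]
  simp only [MvPolynomial.bind₁_X_right, Fin.sum_univ_two]
  rw [← add_assoc]

end Summit.ValiantsHypothesis.ValiantsHypothesis.Theorems
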